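import Summits.CriticalPhenomena.PercolationContinuityZ3.Theorems.PercNearOneGluingNoHeavyLowerTailAntitheticEarSpan
import Summits.CriticalPhenomena.PercolationContinuityZ3.Theorems.PercNearOneGluingNoHeavyLowerTailAntitheticEarFar
import HarnessLib

/-!
# `NoHeavyLowerTail` (stmt-CriticalPhenomena-4575) — antithetic cluster pairs: **THE ⊕-EVENT OF A θ-GRAPH IS BOX-DECOMPOSABLE**
# (cycle + ear, `P` anywhere on the cycle; THEOREM Θ², HOME/MEMO-gen63.md §3; prim-hp-2 gen 63)

Support file (`--supports stmt-CriticalPhenomena-4575`, hull-port prover `prim-hp-2`, gen 63).  No definitions, no named facts, no sorries;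
standard axioms.  Setting of …AntitheticEarTools: cycle `v 0 = s, …, v n = v 0` (`n ≥ 3`), ear `u 0 = v α, …, u ℓ = v β`
(`α < β < n`, `ℓ ≥ 1`, fresh interior, no ear pair a cycle pair), `E = Cyc.edgeSet n v ∪ Cyc.edgeSet ℓ u` — a θ-graph with `s` on it —
and `P = v p`, `0 < p < n`, ANY position on the cycle except the single configuration `α = 0 ∧ p = β` (`s` and `P` are the two poles:
three internally disjoint `s–P` paths, not box-decomposable by lab/boxdec.py).

**`Antithetic.Cyc.ear_boxes`**: `{T : P ∈ X_E T}` is a disjoint union of red-dominated boxes with fixed pairs inside `E` (cover / inside /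
uniqueness / domination).  Cases: `α < p < β` is …AntitheticEarSpan, `β ≤ p` is …AntitheticEarFar, and `p ≤ α` is …AntitheticEarFar for
the REFLECTED cycle `i ↦ v (n - i)` with the reversed ear (…AntitheticCycleReflect).  Since every θ-graph with a marked vertex `P` can be
presented as "cycle through `s` and `P` + ear" (choose the cycle through the paths of `s` and of `P`), this settles box-decomposability
of `{P ∈ X}` for ALL θ-graphs: decomposable iff `{s, P}` is not the pair of poles (machine census: lab/cycle_ear_scheme.py, 1918/1918
configurations with `n ≤ 9`; HOME/MEMO-gen63.md §3).  Consumers: `Antithetic.Box.boxes_sum_nonneg` (⊕-positivity of θ-graphs at `P`),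
`Antithetic.Box.mixed_of_oplus_boxes` (⊕ ⇒ M), and the ⊕-HANDLE THEOREM (THEOREM Θ²: …AntitheticThetaHandle).
[cite: VandenbergHaggstromKahn2005, §1 p. 6 ("Harris' inequality"), §1 p. 3 (open cluster `C_s`)]
-/

noncomputable section

namespace Summit.CriticalPhenomena.PercolationContinuityZ3.Theorems

open Literature.Probability.Percolation
open scoped Classical

namespace Antithetic

namespace Cyc

variable {V : Type*} {n : ℕ} {v : ℕ → V} {ℓ : ℕ} {u : ℕ → V} {α β p : ℕ}

/-- **THE ⊕-EVENT OF A CYCLE WITH AN EAR IS BOX-DECOMPOSABLE** (`P` anywhere on the cycle).  Cycle `v 0 = s, …, v n = v 0` (`n ≥ 3`),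
ear `u 0 = v α, …, u ℓ = v β` (`α < β < n`, `ℓ ≥ 1`, fresh interior, no ear pair a cycle pair), `E = Cyc.edgeSet n v ∪ Cyc.edgeSet ℓ u`,
`P = v p` with `0 < p < n` and not `(α = 0 ∧ p = β)`.  Then there are an index type `C` and boxes `(Fix c, N c)`, `Fix c ⊆ E`, with:
cover (every colouring with `P ∈ X_E` lies in a box), inside (members have `P ∈ X_E`), uniqueness (boxes are disjoint) and red domination
(`Y_E T' ⊆ X_E T` for members `T, T'` opposite off `Fix c`). [this work] -/
theorem ear_boxes (hn : 3 ≤ n) (hinj : ∀ i j, i < n → j < n → v i = v j → i = j) (hper : v n = v 0) (hℓ : 1 ≤ ℓ)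
    (hαβ : α < β) (hβn : β < n) (hp0 : 0 < p) (hpn : p < n) (hexc : ¬ (α = 0 ∧ p = β)) (hu0 : u 0 = v α) (huℓ : u ℓ = v β)
    (hfresh : ∀ j, 0 < j → j < ℓ → ∀ i, i ≤ n → u j ≠ v i) (huinj : ∀ i j, i ≤ ℓ → j ≤ ℓ → u i = u j → i = j)
    (hRC : ∀ m, m < ℓ → ∀ i, i < n → edge u m ≠ edge v i) :
    ∃ (C : Type) (Fix N : C → Set (Sym2 V)),
      (∀ c, Fix c ⊆ edgeSet n v ∪ edgeSet ℓ u) ∧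
      (∀ T : Set (Sym2 V), v p ∈ openCluster (T ∩ (edgeSet n v ∪ edgeSet ℓ u)) (v 0) →
        ∃ c, ∀ e ∈ Fix c, (e ∈ T ↔ e ∈ N c)) ∧
      (∀ c (T : Set (Sym2 V)), (∀ e ∈ Fix c, (e ∈ T ↔ e ∈ N c)) →
        v p ∈ openCluster (T ∩ (edgeSet n v ∪ edgeSet ℓ u)) (v 0)) ∧
      (∀ c c' (T : Set (Sym2 V)), (∀ e ∈ Fix c, (e ∈ T ↔ e ∈ N c)) → (∀ e ∈ Fix c', (e ∈ T ↔ e ∈ N c')) → c = c') ∧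
      (∀ c (T T' : Set (Sym2 V)), (∀ e ∈ Fix c, (e ∈ T ↔ e ∈ N c)) → (∀ e ∈ Fix c, (e ∈ T' ↔ e ∈ N c)) →
        (∀ e ∉ Fix c, (e ∈ T' ↔ e ∉ T)) →
        openCluster (T'ᶜ ∩ (edgeSet n v ∪ edgeSet ℓ u)) (v 0) ⊆ openCluster (T ∩ (edgeSet n v ∪ edgeSet ℓ u)) (v 0)) := by
  rcases Nat.lt_or_ge α p with hαp | hpα
  · rcases Nat.lt_or_ge p β with hpβ | hβp
    · exact ear_span_boxes hn hinj hper hℓ hαp hpβ hβn hu0 huℓ hfresh huinj hRC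
    · exact ear_far_boxes hn hinj hper hℓ hαβ hβp hpn hexc hu0 huℓ hfresh huinj hRC
  · -- `p ≤ α`: reflect the cycle (`i ↦ v (n - i)`) and reverse the ear; then `P` lies beyond the ear
    have key := ear_far_boxes (v := fun i => v (n - i)) (u := fun j => u (ℓ - j)) (α := n - β) (β := n - α) (p := n - p)
      hn (reflect_inj hinj hper) (reflect_per hper) hℓ (by omega) (by omega) (by omega) (by omega)
      (show u (ℓ - 0) = v (n - (n - β)) by rw [Nat.sub_zero, huℓ, show n - (n - β) = β by omega])
      (show u (ℓ - ℓ) = v (n - (n - α)) by rw [Nat.sub_self, hu0, show n - (n - α) = α by omega])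
      (fun j hj0 hjℓ i hi => hfresh (ℓ - j) (by omega) (by omega) (n - i) (by omega))
      (fun i j hi hj h => by have := huinj (ℓ - i) (ℓ - j) (by omega) (by omega) h; omega)
      (fun m hm i hi => by
        rw [edge_reflect hm, edge_reflect hi]
        exact hRC (ℓ - 1 - m) (by omega) (n - 1 - i) (by omega))
    simp only [edgeSet_reflect, show n - (n - p) = p by omega, Nat.sub_zero, hper] at key
    exact key

end Cyc

end Antithetic

end Summit.CriticalPhenomena.PercolationContinuityZ3.Theorems
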